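import Summits.CriticalPhenomena.CardyFormulaZ2.Theorems.ModulusResponseSegmentRSWIffNonSlant
import Summits.CriticalPhenomena.CardyFormulaZ2.Theorems.CardySelfDualSegmentUniformBoxCrossingSplit
import HarnessLib

/-!
# `SegmentRSW` (stmt-CriticalPhenomena-6470) — split glue: the crux from the two halves of
endpoint domination of the corner family

Route `ModulusResponse`, crux `SegmentRSW` (rank 4): u-uniform RSW at aspect ratio 2 along the
self-dual cell segment `μ_u`, `u ∈ [0, 1/2]`. In the tree the crux is EQUIVALENT to the sibling
crux `UniformBoxCrossing` of route `CardySelfDualSegment` (`segmentRSW_iff_uniformBoxCrossing`,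
Theorems/ModulusResponseSegmentRSWIffNonSlant.lean: the cell law is the point reflection of the
corner law, `μ_u = (cornerPercolation ⟨2u⟩).map (relabel neg)`, `stub_cellLaw`), and both are
equivalent to the one-scale kernel `NonSlantStatement` — twelve lead cycles (c0–c11) on this item
and six on the sibling ended on that kernel.

This file is the crux-strategist's DECOMPOSITION glue (seat `cstrat-stmt-CriticalPhenomena-6470-s1`,
2026-08-17): `SegmentRSW ⟸ EndpointDominationU ∧ EndpointDominationW`, the two one-endpoint
comparison statements of the sibling kernel (`stub_endpointDomination`, lead c4 of stmt-5476;
package `Cruxes/UniformBoxCrossing/SPLIT-EndpointDomination.md`), stated SELF-CONTAINED exactly as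
in that package — with the inlined coin model `prm` / `cfg` (literally `cornerParam` /
`cornerConfig`, so `M t = cornerPercolation t` by `cornerPercolation_def`) and the diamond drawing
`dia A B v = (v₀ - v₁) + (v₀ + v₁)·i - (A + B·i)` (literally `TrackExchange.zDia v - (A + B·i)`) —
so that `route edit --split SegmentRSW … --glue-by` can quote the hypotheses verbatim and the two
children DEDUPLICATE with the sibling's halves (same normalised signatures):

* first hypothesis — ENDPOINT DOMINATION, u-half (anchor `t = 0`, site percolation on the triangular lattice of
  corners = Smirnov's point `u = 0` of this route): for every `t ∈ [0,1]` the `M_t`-probability of a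
  u-crossing of the turned `m × 2m` box is at least its `M_0`-probability, eventually in `m`, at
  every integer position (`λ_t ≤ λ_0 = √3`);
* second hypothesis — ENDPOINT DOMINATION, w-half (anchor `t = 1`, bond-`ℤ²` at `1/2` = this route's `u = 1/2`):
  the `M_t`-probability of a w-crossing of the turned `2m × m` box is at least its
  `M_1`-probability (`λ_t ≥ λ_1 = 1`).

Proof: glue only — `uniformBoxCrossing_of_endpointDominationU_W` (p151553) gives t-uniform
`BoxCrossingBounds` for `cornerPercolation t`, which is `UniformBoxCrossing` by `Iff.rfl`
(`uniformBoxCrossing_iff_boxCrossingBounds_cornerPercolation`), and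
`segmentRSW_of_uniformBoxCrossing` (p146906: cell/corner transfer `cellCornerTransfer`, reflected
crossing events, aspect-2 specialisation) concludes the crux BY NAME. Both halves are open
(KERNEL-DOSSIER-c4/c5 of the sibling: a sign without a handle; the atomic per-(environment, corner)
strengthening is FALSE on both sides, only summed / ψ / microcanonical forms can hold; the sibling's
live skeleton attacks them through `stub_microcanonicalU` / `stub_microcanonicalW`, glue
Theorems/CardySelfDualSegmentUniformBoxCrossingOfMicrocanonical.lean).
-/

namespace Summit.CriticalPhenomena.CardyFormulaZ2.Cruxes.SegmentRSW.Split

open Summit.CriticalPhenomena.CardyFormulaZ2.Theses.ModulusResponse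
open Summit.CriticalPhenomena.CardyFormulaZ2.Cruxes.SegmentRSW.Birth
open Summit.CriticalPhenomena.CardyFormulaZ2.Cruxes.UniformBoxCrossing.NonSlantLine

/-- **Split glue for `SegmentRSW` (crux-strategist decomposition, registered stub
`SegmentRSW_of_subs`).** The two halves of endpoint domination for the turned 2:1 boxes of the
corner family `M_t = cornerPercolation t` — u-crossings of the `m × 2m` boxes never below their
`t = 0` (site-`𝕋`) value, w-crossings of the `2m × m` boxes never below their `t = 1` (bond-`ℤ²`)
value, both eventually in `m` and at every integer position, stated with the inlined coin model and
the diamond drawing written out — imply the crux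
`Summit.CriticalPhenomena.CardyFormulaZ2.Theses.ModulusResponse.SegmentRSW` (u-uniform aspect-2 RSW
along the self-dual cell segment). Glue only: `uniformBoxCrossing_of_endpointDominationU_W`, then
`Iff.rfl` to `UniformBoxCrossing`, then `segmentRSW_of_uniformBoxCrossing`.
[cite: BollobasRiordan2010, §5.1 Thm. 5.3] -/
theorem SegmentRSW_of_subs : (let prm : unitInterval → Literature.Probability.LatticeModels.Site 2 × Fin 2 → unitInterval := fun t i => if i.2 = 0 then Literature.Probability.Percolation.half else Literature.Probability.Percolation.half * t; let cfg : Set (Literature.Probability.LatticeModels.Site 2 × Fin 2) → Literature.Probability.Percolation.BondConfig (Literature.Probability.LatticeModels.Site 2) := fun S => {e | ∃ v : Literature.Probability.LatticeModels.Site 2, (e = s(v, v + ![1, 0]) ∧ (v, (0 : Fin 2)) ∈ S) ∨ (e = s(v, v + ![0, 1]) ∧ ((v, (0 : Fin 2)) ∈ S ↔ (v, (1 : Fin 2)) ∉ S))}; let M : unitInterval → MeasureTheory.Measure (Literature.Probability.Percolation.BondConfig (Literature.Probability.LatticeModels.Site 2)) := fun t => (Literature.Probability.LatticeModels.prodBernoulli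 (prm t)).map cfg; let dia : ℤ → ℤ → Literature.Probability.LatticeModels.Site 2 → ℂ := fun A B v => ((v 0 - v 1 : ℤ) : ℂ) + ((v 0 + v 1 : ℤ) : ℂ) * Complex.I - ((A : ℂ) + (B : ℂ) * Complex.I); ∃ m₁ : ℕ, ∀ m : ℕ, m₁ ≤ m → ∀ (A B : ℤ) (t : unitInterval), (M 0).real (Literature.Probability.LatticeModels.embTBCrossing (dia A B) m (2 * m)) ≤ (M t).real (Literature.Probability.LatticeModels.embTBCrossing (dia A B) m (2 * m))) → (let prm : unitInterval → Literature.Probability.LatticeModels.Site 2 × Fin 2 → unitInterval := fun t i => if i.2 = 0 then Literature.Probability.Percolation.half else Literature.Probability.Percolation.half * t; let cfg : Set (Literature.Probability.LatticeModels.Site 2 × Fin 2) → Literature.Probability.Percolation.BondConfig (Literature.Probability.LatticeModels.Site 2) := fun S => {e | ∃ v : Literature.Probability.LatticeModels.Site 2, (e = s(v, v + ![1, 0]) ∧ (v, (0 : Fin 2)) ∈ S) ∨ (e = s(v, v + ![0, 1]) ∧ ((v, (0 : Fin 2)) ∈ S ↔ (v, (1 : Fin 2)) ∉ S))}; let M :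 unitInterval → MeasureTheory.Measure (Literature.Probability.Percolation.BondConfig (Literature.Probability.LatticeModels.Site 2)) := fun t => (Literature.Probability.LatticeModels.prodBernoulli (prm t)).map cfg; let dia : ℤ → ℤ → Literature.Probability.LatticeModels.Site 2 → ℂ := fun A B v => ((v 0 - v 1 : ℤ) : ℂ) + ((v 0 + v 1 : ℤ) : ℂ) * Complex.I - ((A : ℂ) + (B : ℂ) * Complex.I); ∃ m₁ : ℕ, ∀ m : ℕ, m₁ ≤ m → ∀ (A B : ℤ) (t : unitInterval), (M 1).real (Literature.Probability.LatticeModels.embRectCrossing (dia A B) (2 * m) m) ≤ (M t).real (Literature.Probability.LatticeModels.embRectCrossing (dia A B) (2 * m) m)) → Summit.CriticalPhenomena.CardyFormulaZ2.Theses.ModulusResponse.SegmentRSW :=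
  fun hU hW =>
    segmentRSW_of_uniformBoxCrossing
      (uniformBoxCrossing_iff_boxCrossingBounds_cornerPercolation.2
        (uniformBoxCrossing_of_endpointDominationU_W hU hW))

end Summit.CriticalPhenomena.CardyFormulaZ2.Cruxes.SegmentRSW.Split
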